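import Summits.BirchSwinnertonDyer.Rank1Residual.X2.TamagawaSqueeze
import Summits.BirchSwinnertonDyer.Rank1Residual.X2.IsogenyQuotientLine
import Literature.NumberTheory.EllipticCurves.PAdicLFunctionMultiplicativeFunctionalEquationProofs
import Literature.NumberTheory.EllipticCurves.CuspFormLFunctionLevelConductorProofs
import Literature.NumberTheory.EllipticCurves.ModularCurveManinSemistableBridgeProofs
import Literature.NumberTheory.EllipticCurves.LeadingTermPPartProofs
import HarnessLib

/-!
# Route `EisensteinPrimes`, line `mudescent`, stub `stub_lambdaCount_offLocus` — the ANALYTIC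
# conjunct `X2.AnalyticLambdaEq W₀ p n` is WELL DEFINED and a ℚ-ISOGENY-CLASS invariant
# (helper file 1/2; closes nothing)

Seat `bsd-eis-lam-a` (PROGRAMME PART 1b, ACCEL-LIST (4): "ANALYTIC side of
`stub_lambdaCount_offLocus`", items stmt-BirchSwinnertonDyer-19033 = crux 3 `MazurMCOnCellB` and
-19035 = crux 5 `MazurMCOnX1RankZero`; skeleton owner bsd-eis-ky, `Lines/mudescent.lean`).
Companion file 2/2: `EisensteinPrimesAnalyticLambdaCruxSized` (given `μ_an = 0`, stub 4 at a pair
⟺ Mazur's main conjecture at the pair).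

HONEST FRAMING. Nothing here proves a main conjecture or moves a label. The registered stub reads
`X2.CellB W₀ p → ¬HasRamifiedOddLineAt W₀ p → ∃ n k, X2.AnalyticLambdaEq W₀ p n ∧
X1.TamagawaSqueeze.AlgebraicLambdaGE W₀ p k ∧ (¬split → n ≤ k) ∧ (split → n ≤ k + 1)`. This file
settles the status of its ANALYTIC conjunct with KERNEL theorems (no new named fact, no definition):

* §1 `lam_C_mul` — `λ(c·g) = λ(g)` for a nonzero constant `c ∈ ℤ_p` (the analytic `λ` is blind to
  the period normalisation; only `μ` sees it).
* §2 `padicL_eq_of_isIsogenous`, `lam_eq_lam_of_isIsogenous_of_data` — for ℚ-isogenous `W ∼ W'`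
  and ANY two admissible data `(f, ϖ, L, G)` for `(W, p)` and `(f', ϖ', L', G')` for `(W', p)`
  (newform, Néron normalisation `ϖ·Ω = Ω⁺_f`, THE Mazur–Tate–Teitelbaum function read through the
  split/non-split dichotomy, `ι G = ϖ·L`), `L = L'` and `λ(G) = λ(G')`. Inputs, all theorems of the
  tree: strong multiplicity one across levels (`IsNewformOf.level_eq_level`, `IsNewformOf.unique`),
  isogenous curves share the newform (`IsNewformOf.of_isIsogenous`) and the split/non-split type
  (`X2.IsogenyQuotientLine.hasSplitMultiplicativeReductionAtPrime_iff_of_isIsogenous`), uniqueness of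
  the MTT package (`IsMultPAdicLFunctionOf.unique`), injectivity of `ι`, `Ω⁺_f > 0`.
* §3 `exists_analyticLambdaEq` — `∃ n, X2.AnalyticLambdaEq W p n` for EVERY `(W, p)`
  (UNCONDITIONAL: the typed analytic `λ` is a well-defined number, the value `λ(G)` of any integral
  datum, vacuous if none exists); `analyticLambdaEq_unique`; `analyticLambdaEq_of_isIsogenous` —
  the analytic conjunct is a CLASS statement (transport from any member carrying an integral datum;
  at a reducible multiplicative odd `p` Wuthrich 2014 Thm. 16 provides one on every member:
  `exists_data`, `analyticLambdaEq_iff_of_isIsogenous`). The analytic twin of lam-b's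
  `EisensteinPrimesAlgebraicLambdaGEIsogeny.algebraicLambdaGE_of_isIsogenous` (p459740): BOTH
  conjuncts of stub 4 are class invariants.

WHAT THIS SAYS TO THE LINE (numbers, not adjectives). (i) The conjunct `X2.AnalyticLambdaEq W₀ p n`
needs no published fact and no construction: it is inhabited by `n := λ_an(W₀, p) = λ_an(W, p)` of
the displayed member (§3); per pair it is the census certificate, now transportable to `W₀`.
(ii) Hence the CONTENT of stub 4 is the single inequality `λ(X(W₀/ℚ_∞)) ≥ λ_an − e` (file 2/2:
equivalent to Mazur's main conjecture at the pair, given stub 3). (iii) The ACCEL mechanism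
"λ_an = λ_φ + λ_ψ + Σδ typed as a PUB fact for the off-locus member" has no printed instance on a
¬GVPar row: Greenberg–Vatsal 2000 p. 42 state the Eisenstein congruence Thm. (3.11) for the
ADMISSIBLE sign `−ψ_unr(−1)`, which at every étale end of a type-A class is `−` (the unramified
character is the even SUB `φ`), not the cyclotomic sign `+`; p. 5 "if E is a quadratic twist of J
by an even character, we can prove very little"; and the count is numerically false at (11a3, 5)
(lam-b MEMO-1 §4: count 1, `λ_an = 0`).

References: [GreenbergVatsal2000] (1)–(3), p. 5, p. 28, §3 p. 42; [MazurTateTeitelbaum1986Invent]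
§I.10, §I.14; [Wuthrich2014] Thm. 16; [AtkinLehner1970] Thm. 4; HOME/lam-b-MEMO-1.md;
HOME/bsd-eis-ky-MEMO-4-K5.md §3.
-/

set_option linter.dupNamespace false
set_option autoImplicit false

noncomputable section

open scoped Classical MatrixGroups ModularForm TensorProduct

open PowerSeries CongruenceSubgroup WeierstrassCurve Literature.NumberTheory.EllipticCurves
  Literature.NumberTheory.EllipticCurves.ModularForms
  Literature.NumberTheory.EllipticCurves.Rank1Residual
  Literature.NumberTheory.EllipticCurves.Wuthrich2014
  Summit.BirchSwinnertonDyer.Rank1Residual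
  Summit.BirchSwinnertonDyer.Rank1Residual.X1.MuLambda
  Summit.BirchSwinnertonDyer.Rank1Residual.X1.ParitySqueeze
  Summit.BirchSwinnertonDyer.Rank1Residual.X1.TamagawaSqueeze

namespace Summit.BirchSwinnertonDyer.BirchSwinnertonDyer.Theorems.EisensteinPrimesAnalyticLambdaCalculus

/-! ## §1. Algebra: `λ` is blind to nonzero constants -/

section Algebra

variable {p : ℕ} [Fact p.Prime]

/-- `λ(c·g) = λ(g)` for a nonzero constant `c ∈ ℤ_p` and `g ≠ 0`: write `c = u·p^v` with `u` a
unit (`PadicInt.unitCoeff_spec`); `λ(p^v·g) = λ(g)` (tree `lam_C_pow_mul`) and units have `λ = 0`.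
The analytic `λ`-invariant does not see the period normalisation. [folklore] -/
theorem lam_C_mul {c : ℤ_[p]} (hc : c ≠ 0) {g : IwasawaAlgebra p} (hg : g ≠ 0) :
    lam (PowerSeries.C c * g) = lam g := by
  have hdec := PadicInt.unitCoeff_spec hc
  set u : ℤ_[p]ˣ := PadicInt.unitCoeff hc with hu
  have hCu : IsUnit (PowerSeries.C (u : ℤ_[p]) : IwasawaAlgebra p) :=
    (Units.isUnit u).map PowerSeries.C
  have hCu0 : (PowerSeries.C (u : ℤ_[p]) : IwasawaAlgebra p) ≠ 0 := hCu.ne_zero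
  have hpg : PowerSeries.C ((p : ℤ_[p]) ^ c.valuation) * g ≠ 0 := mul_ne_zero (C_pow_ne_zero _) hg
  calc lam (PowerSeries.C c * g)
      = lam (PowerSeries.C (u : ℤ_[p]) * (PowerSeries.C ((p : ℤ_[p]) ^ c.valuation) * g)) := by
        conv_lhs => rw [hdec]
        rw [map_mul, mul_assoc]
    _ = lam (PowerSeries.C ((p : ℤ_[p]) ^ c.valuation) * g) := by
        rw [lam_mul hCu0 hpg, lam_eq_zero_of_isUnit hCu, zero_add]
    _ = lam g := lam_C_pow_mul _ hg

/-- `ι(C c · g) = C c · ι(g)` for `c ∈ ℤ_p` (`ι` is a ring map and `ι(C c) = C c`). [folklore] -/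
theorem iwasawaToPowerSeries_C_mul (c : ℤ_[p]) (g : IwasawaAlgebra p) :
    iwasawaToPowerSeries p (PowerSeries.C c * g) =
      PowerSeries.C (c : ℚ_[p]) * iwasawaToPowerSeries p g := by
  rw [map_mul, iwasawaToPowerSeries, PowerSeries.map_C]
  rfl

end Algebra

/-! ## §2. Two admissible data of ℚ-isogenous curves have the same `λ` -/

section Data

variable {W W' : WeierstrassCurve ℚ} [W.IsElliptic] [W.IsGloballyMinimal] [W'.IsElliptic]
  [W'.IsGloballyMinimal] {p : ℕ} [Fact p.Prime]

omit [W.IsElliptic] [W.IsGloballyMinimal] in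
/-- `ϖ ≠ 0` and `Ω(W) ≠ 0` when `ϖ·Ω(W) = Ω⁺_f > 0`. [folklore] -/
theorem varpi_ne_zero_and_realPeriodRat_ne_zero {N : ℕ} [NeZero N] {f : CuspForm (Gamma0 N) 2}
    (hf : IsNewformOf W f) {ϖ : ℚ} (hϖ : (ϖ : ℝ) * W.realPeriodRat = plusPeriod f) :
    ϖ ≠ 0 ∧ W.realPeriodRat ≠ 0 := by
  have hper : 0 < plusPeriod f := IsNewform0.plusPeriod_pos_holds hf.1 hf.coeffField_eq_bot
  rw [← hϖ] at hper
  exact ⟨fun h ↦ by rw [h, Rat.cast_zero, zero_mul] at hper; exact lt_irrefl _ hper,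
    fun h ↦ by rw [h, mul_zero] at hper; exact lt_irrefl _ hper⟩

omit [W.IsGloballyMinimal] [W'.IsGloballyMinimal] in
/-- **THE Mazur–Tate–Teitelbaum function of an isogeny class is one power series.** If `f`
(level `N`) is a newform of `W` and `f'` (level `N'`) a newform of the ℚ-isogenous `W'`, and
`L`, `L'` are THE multiplicative `p`-adic `L`-functions in the sense of `X2.AnalyticLambdaEq`
(split ⇒ `IsSplitMultPAdicLFunctionOf`, non-split ⇒ `IsMultPAdicLFunctionOf · p (−1)`, the
dichotomy read on `W` resp. `W'`) at a multiplicative `p`, then `L = L'`: same newform across levels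
(Atkin–Lehner strong multiplicity one, `IsNewformOf.level_eq_level` / `.unique`, and
`IsNewformOf.of_isIsogenous`), same reduction type (`…hasSplitMultiplicativeReductionAtPrime_iff_of_isIsogenous`),
and the MTT package is unique (`IsMultPAdicLFunctionOf.unique`). No reduction hypothesis is
needed (the dichotomy is read formally). [cite: MazurTateTeitelbaum1986Invent, §I.14 (14.3)]
[cite: AtkinLehner1970, Thm. 4] -/
theorem padicL_eq_of_isIsogenous (hiso : IsIsogenous W W')
    {N : ℕ} [NeZero N] {f : CuspForm (Gamma0 N) 2} (hf : IsNewformOf W f)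
    {N' : ℕ} [NeZero N'] {f' : CuspForm (Gamma0 N') 2} (hf' : IsNewformOf W' f')
    {L L' : PowerSeries ℚ_[p]}
    (hLs : W.HasSplitMultiplicativeReductionAtPrime p → IsSplitMultPAdicLFunctionOf f p L)
    (hLn : ¬ W.HasSplitMultiplicativeReductionAtPrime p → IsMultPAdicLFunctionOf f p (-1) L)
    (hLs' : W'.HasSplitMultiplicativeReductionAtPrime p → IsSplitMultPAdicLFunctionOf f' p L')
    (hLn' : ¬ W'.HasSplitMultiplicativeReductionAtPrime p → IsMultPAdicLFunctionOf f' p (-1) L') :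
    L = L' := by
  -- `f'` is also a newform of `W`; levels agree, then the forms agree
  have hf'W : IsNewformOf W f' := hf'.of_isIsogenous hiso
  obtain rfl : N = N' := hf.level_eq_level hf'W
  obtain rfl : f = f' := hf.unique hf'W
  have hsplit_iff : W.HasSplitMultiplicativeReductionAtPrime p ↔
      W'.HasSplitMultiplicativeReductionAtPrime p :=
    X2.IsogenyQuotientLine.hasSplitMultiplicativeReductionAtPrime_iff_of_isIsogenous hiso
  by_cases hs : W.HasSplitMultiplicativeReductionAtPrime p
  · have h1 : IsMultPAdicLFunctionOf f p 1 L := (isMultPAdicLFunctionOf_one_iff L).mpr (hLs hs)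
    have h2 : IsMultPAdicLFunctionOf f p 1 L' :=
      (isMultPAdicLFunctionOf_one_iff L').mpr (hLs' (hsplit_iff.mp hs))
    exact h1.unique h2
  · exact (hLn hs).unique (hLn' (fun h ↦ hs (hsplit_iff.mpr h)))

omit [W.IsGloballyMinimal] [W'.IsGloballyMinimal] in
/-- **Two admissible data of ℚ-isogenous curves have the same analytic `λ`.** With `W ∼ W'`
globally minimal, data `(f, ϖ, L, G)` for `W` and `(f', ϖ', L', G')`
for `W'` as in `X2.AnalyticLambdaEq` (`ϖ·Ω(W) = Ω⁺_f`, `ι G = ϖ·L`, etc.): `λ(G) = λ(G')`.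
Proof: `L = L'` (`padicL_eq_of_isIsogenous`) and `Ω⁺_f = Ω⁺_{f'}`, so `ϖ'·ι G = ϖ·ι G'` with
`ϖ, ϖ' ∈ ℚˣ`; whichever of `ϖ'/ϖ`, `ϖ/ϖ'` is `p`-integral exhibits one of `G, G'` as a NONZERO
`ℤ_p`-constant multiple of the other inside `Λ` (`ι` injective), and `λ` is blind to such constants
(`lam_C_mul`) — Greenberg–Vatsal p. 28 "λ is unchanged by an isogeny" on the analytic side, where
only the period (hence `μ`) moves. [cite: GreenbergVatsal2000, p. 28 and (1)–(3)] -/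
theorem lam_eq_lam_of_isIsogenous_of_data (hiso : IsIsogenous W W')
    {N : ℕ} [NeZero N] {f : CuspForm (Gamma0 N) 2} (hf : IsNewformOf W f)
    {N' : ℕ} [NeZero N'] {f' : CuspForm (Gamma0 N') 2} (hf' : IsNewformOf W' f')
    {ϖ ϖ' : ℚ} (hϖ : (ϖ : ℝ) * W.realPeriodRat = plusPeriod f)
    (hϖ' : (ϖ' : ℝ) * W'.realPeriodRat = plusPeriod f')
    {L L' : PowerSeries ℚ_[p]}
    (hLs : W.HasSplitMultiplicativeReductionAtPrime p → IsSplitMultPAdicLFunctionOf f p L)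
    (hLn : ¬ W.HasSplitMultiplicativeReductionAtPrime p → IsMultPAdicLFunctionOf f p (-1) L)
    (hLs' : W'.HasSplitMultiplicativeReductionAtPrime p → IsSplitMultPAdicLFunctionOf f' p L')
    (hLn' : ¬ W'.HasSplitMultiplicativeReductionAtPrime p → IsMultPAdicLFunctionOf f' p (-1) L')
    {G G' : IwasawaAlgebra p}
    (hG : iwasawaToPowerSeries p G = PowerSeries.C ((ϖ : ℚ) : ℚ_[p]) * L)
    (hG' : iwasawaToPowerSeries p G' = PowerSeries.C ((ϖ' : ℚ) : ℚ_[p]) * L') :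
    lam G = lam G' := by
  have hLL : L = L' := padicL_eq_of_isIsogenous hiso hf hf' hLs hLn hLs' hLn'
  -- same newform, hence the same `Ω⁺`
  have hf'W : IsNewformOf W f' := hf'.of_isIsogenous hiso
  obtain rfl : N = N' := hf.level_eq_level hf'W
  obtain rfl : f = f' := hf.unique hf'W
  subst hLL
  obtain ⟨hϖ0, -⟩ := varpi_ne_zero_and_realPeriodRat_ne_zero hf hϖ
  obtain ⟨hϖ0', -⟩ := varpi_ne_zero_and_realPeriodRat_ne_zero hf' hϖ'
  have hι := iwasawaToPowerSeries_injective p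
  -- the ratio `r = ϖ'/ϖ`: `C ϖ' * L = C r * (C ϖ * L)`
  set r : ℚ := ϖ' / ϖ with hr
  have hr0 : r ≠ 0 := div_ne_zero hϖ0' hϖ0
  have hrel : PowerSeries.C ((ϖ' : ℚ) : ℚ_[p]) * L =
      PowerSeries.C ((r : ℚ) : ℚ_[p]) * (PowerSeries.C ((ϖ : ℚ) : ℚ_[p]) * L) := by
    rw [← mul_assoc, ← map_mul]
    congr 2
    have : ((ϖ' : ℚ) : ℚ_[p]) = ((r * ϖ : ℚ) : ℚ_[p]) := by rw [hr, div_mul_cancel₀ _ hϖ0]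
    rw [this]; push_cast; ring
  by_cases hG0 : G = 0
  · -- then `ϖ·L = 0`, so `L = 0`, so `G' = 0`
    have hL0 : L = 0 := by
      have h0 : PowerSeries.C ((ϖ : ℚ) : ℚ_[p]) * L = 0 := by rw [← hG, hG0, map_zero]
      rcases mul_eq_zero.mp h0 with hC | hL
      · exfalso
        have h1 := congrArg PowerSeries.constantCoeff hC
        rw [PowerSeries.constantCoeff_C, map_zero] at h1
        exact hϖ0 (by exact_mod_cast h1)
      · exact hL
    have hG'0 : G' = 0 := hι (by rw [hG', hL0, mul_zero, map_zero])
    rw [hG0, hG'0]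
  · rcases le_or_gt ‖((r : ℚ) : ℚ_[p])‖ 1 with hle | hgt
    · -- `r ∈ ℤ_p`: `G' = C r · G`
      set c : ℤ_[p] := ⟨((r : ℚ) : ℚ_[p]), hle⟩ with hc
      have hc0 : c ≠ 0 := by
        intro h
        have : ((r : ℚ) : ℚ_[p]) = 0 := by
          have := congrArg (Subtype.val) h
          simpa [hc] using this
        exact hr0 (by exact_mod_cast this)
      have hGG : G' = PowerSeries.C c * G := by
        apply hι
        rw [iwasawaToPowerSeries_C_mul, hG', hrel, hG]
      rw [hGG, lam_C_mul hc0 hG0]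
    · -- `r⁻¹ ∈ ℤ_p`: `G = C r⁻¹ · G'`
      have hle' : ‖((r⁻¹ : ℚ) : ℚ_[p])‖ ≤ 1 := by
        push_cast
        rw [norm_inv]
        exact inv_le_one_of_one_le₀ hgt.le
      set c : ℤ_[p] := ⟨((r⁻¹ : ℚ) : ℚ_[p]), hle'⟩ with hc
      have hc0 : c ≠ 0 := by
        intro h
        have : ((r⁻¹ : ℚ) : ℚ_[p]) = 0 := by
          have := congrArg (Subtype.val) h
          simpa [hc] using this
        exact (inv_ne_zero hr0) (by exact_mod_cast this)
      have hrQ0 : ((r : ℚ) : ℚ_[p]) ≠ 0 := by exact_mod_cast hr0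
      have hGG : G = PowerSeries.C c * G' := by
        apply hι
        rw [iwasawaToPowerSeries_C_mul, hG', hrel, hG, ← mul_assoc, ← map_mul]
        have : (c : ℚ_[p]) * ((r : ℚ) : ℚ_[p]) = 1 := by
          rw [hc]; push_cast; exact inv_mul_cancel₀ hrQ0
        rw [this, map_one, one_mul]
      have hG'0 : G' ≠ 0 := by
        intro h; apply hG0; rw [hGG, h, mul_zero]
      rw [hGG, lam_C_mul hc0 hG'0]

end Data

/-! ## §3. The analytic conjunct is inhabited, single-valued and a class invariant -/

section Conjunct

variable {W W' : WeierstrassCurve ℚ} [W.IsElliptic] [W.IsGloballyMinimal] [W'.IsElliptic]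
  [W'.IsGloballyMinimal] {p : ℕ} [Fact p.Prime]

/-- **The typed analytic `λ` is well defined: `∃ n, X2.AnalyticLambdaEq W p n`, for EVERY
globally minimal elliptic `W/ℚ` and every prime `p`.** If some admissible integral
datum `(f, ϖ, L, G)` exists, `n := λ(G)` works for all data (`lam_eq_lam_of_isIsogenous_of_data`
with `W' = W`); otherwise every `n` works vacuously. UNCONDITIONAL — so the `AnalyticLambdaEq`
conjunct of `stub_lambdaCount_offLocus` carries no construction; the stub's content is the
comparison `n ≤ k (+1)`. [cite: GreenbergVatsal2000, (1)–(2)] -/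
theorem exists_analyticLambdaEq : ∃ n : ℕ, X2.AnalyticLambdaEq W p n := by
  by_cases h : ∃ (N : ℕ) (_ : NeZero N) (f : CuspForm (Gamma0 N) 2) (ϖ : ℚ) (L : PowerSeries ℚ_[p])
      (G : IwasawaAlgebra p), IsNewformOf W f ∧ (ϖ : ℝ) * W.realPeriodRat = plusPeriod f ∧
      (W.HasSplitMultiplicativeReductionAtPrime p → IsSplitMultPAdicLFunctionOf f p L) ∧
      (¬ W.HasSplitMultiplicativeReductionAtPrime p → IsMultPAdicLFunctionOf f p (-1) L) ∧
      iwasawaToPowerSeries p G = PowerSeries.C ((ϖ : ℚ) : ℚ_[p]) * L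
  · obtain ⟨N, _, f, ϖ, L, G, hf, hϖ, hLs, hLn, hG⟩ := h
    refine ⟨lam G, fun f' hf' ϖ' hϖ' L' hLs' hLn' G' hG' ↦ ?_⟩
    exact (lam_eq_lam_of_isIsogenous_of_data (IsIsogenous.refl_holds (W := W)) hf hf' hϖ hϖ'
      hLs hLn hLs' hLn' hG hG').symm
  · refine ⟨0, fun f' hf' ϖ' hϖ' L' hLs' hLn' G' hG' ↦ ?_⟩
    exact absurd ⟨_, inferInstance, f', ϖ', L', G', hf', hϖ', hLs', hLn', hG'⟩ h

/-- **Single-valuedness**: if `X2.AnalyticLambdaEq W p n` and `X2.AnalyticLambdaEq W p m` and ONE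
admissible integral datum exists, then `n = m`. [folklore] -/
theorem analyticLambdaEq_unique {n m : ℕ} (hn : X2.AnalyticLambdaEq W p n)
    (hm : X2.AnalyticLambdaEq W p m)
    {N : ℕ} [NeZero N] {f : CuspForm (Gamma0 N) 2} (hf : IsNewformOf W f)
    {ϖ : ℚ} (hϖ : (ϖ : ℝ) * W.realPeriodRat = plusPeriod f) {L : PowerSeries ℚ_[p]}
    (hLs : W.HasSplitMultiplicativeReductionAtPrime p → IsSplitMultPAdicLFunctionOf f p L)
    (hLn : ¬ W.HasSplitMultiplicativeReductionAtPrime p → IsMultPAdicLFunctionOf f p (-1) L)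
    {G : IwasawaAlgebra p} (hG : iwasawaToPowerSeries p G = PowerSeries.C ((ϖ : ℚ) : ℚ_[p]) * L) :
    n = m :=
  (hn f hf ϖ hϖ L hLs hLn G hG).symm.trans (hm f hf ϖ hϖ L hLs hLn G hG)

/-- **The analytic conjunct is a ℚ-ISOGENY-CLASS statement (transport).** `W ∼ W'` globally
minimal, `p` multiplicative for `W`; if `(W, p)` carries ONE admissible integral datum
`(f, ϖ, L, G)` (at a reducible multiplicative odd `p` Wuthrich 2014 Thm. 16 provides it, see
`analyticLambdaEq_iff_of_isIsogenous`), then `X2.AnalyticLambdaEq W p n → X2.AnalyticLambdaEq W' p n`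
(no reduction hypothesis).
The analytic twin of lam-b's `algebraicLambdaGE_of_isIsogenous`: BOTH conjuncts of stub 4 are class
invariants, so the stub at the étale end `W₀` is the stub at the displayed member.
[cite: GreenbergVatsal2000, p. 28] -/
theorem analyticLambdaEq_of_isIsogenous (hiso : IsIsogenous W W')
    {N : ℕ} [NeZero N] {f : CuspForm (Gamma0 N) 2} (hf : IsNewformOf W f)
    {ϖ : ℚ} (hϖ : (ϖ : ℝ) * W.realPeriodRat = plusPeriod f) {L : PowerSeries ℚ_[p]}
    (hLs : W.HasSplitMultiplicativeReductionAtPrime p → IsSplitMultPAdicLFunctionOf f p L)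
    (hLn : ¬ W.HasSplitMultiplicativeReductionAtPrime p → IsMultPAdicLFunctionOf f p (-1) L)
    {G : IwasawaAlgebra p} (hG : iwasawaToPowerSeries p G = PowerSeries.C ((ϖ : ℚ) : ℚ_[p]) * L)
    {n : ℕ} (hn : X2.AnalyticLambdaEq W p n) : X2.AnalyticLambdaEq W' p n := by
  intro N' _ f' hf' ϖ' hϖ' L' hLs' hLn' G' hG'
  rw [← hn f hf ϖ hϖ L hLs hLn G hG]
  exact (lam_eq_lam_of_isIsogenous_of_data hiso hf hf' hϖ hϖ' hLs hLn hLs' hLn' hG hG').symm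

/-- **An admissible integral datum exists at every reducible multiplicative odd `p`** (Wuthrich
2014 Thm. 16 `hWu` supplies `G = T^e·g ∈ Λ` with `ι G = ϖ·L`; modularity `hpar` supplies the
newform and `ϖ`; THE MTT function exists by the tree theorems `exists_isSplitMultPAdicLFunctionOf`
/ `exists_isMultPAdicLFunctionOf_neg_one_of_nonsplit`). [cite: Wuthrich2014, Thm. 16 (p. 397)]
[cite: MazurTateTeitelbaum1986Invent, §I.10 Prop.] -/
theorem exists_data (hWu : thm16_charIdeal_dvd_multiplicative_of_reducible)
    (hpar : nonempty_modularParametrizationData) (hp2 : p ≠ 2)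
    (hmult : W.HasMultiplicativeReductionAtPrime p) (hred : ¬ W.HasIrreducibleModPGaloisRep p) :
    ∃ (N : ℕ) (_ : NeZero N) (f : CuspForm (Gamma0 N) 2) (ϖ : ℚ) (L : PowerSeries ℚ_[p])
      (G : IwasawaAlgebra p), IsNewformOf W f ∧ (ϖ : ℝ) * W.realPeriodRat = plusPeriod f ∧
      (W.HasSplitMultiplicativeReductionAtPrime p → IsSplitMultPAdicLFunctionOf f p L) ∧
      (¬ W.HasSplitMultiplicativeReductionAtPrime p → IsMultPAdicLFunctionOf f p (-1) L) ∧
      iwasawaToPowerSeries p G = PowerSeries.C ((ϖ : ℚ) : ℚ_[p]) * L := by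
  haveI : NeZero (W.conductorNorm ℤ) := ⟨(W.conductorNorm_pos_holds).ne'⟩
  obtain ⟨Dm⟩ := hpar W
  have hf : IsNewformOf W Dm.f := Dm.isNewformOf
  obtain ⟨ϖ, -, hϖ, -⟩ := Dm.exists_rat_mul_realPeriodRat_eq_plusPeriod
  obtain ⟨κ, hκ, γ, hγ, hγ'⟩ := exists_isCyclotomic_isTopGenerator_isCyclotomicVariable_holds p
  obtain ⟨D⟩ := W.nonempty_selmerDualData_holds κ γ hγ
  obtain ⟨-, hKns, hKs⟩ := hWu W p hp2 hmult hred hκ hγ hγ' hf D ϖ hϖ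
  by_cases hs : W.HasSplitMultiplicativeReductionAtPrime p
  · obtain ⟨L, hL⟩ := exists_isSplitMultPAdicLFunctionOf hs hf
    obtain ⟨g, -, hιg⟩ := hKs hs L hL
    exact ⟨_, inferInstance, Dm.f, ϖ, L, PowerSeries.X * g, hf, hϖ, fun _ ↦ hL,
      fun hns ↦ absurd hs hns, hιg⟩
  · obtain ⟨L, hL⟩ := exists_isMultPAdicLFunctionOf_neg_one_of_nonsplit hf hmult hs
    obtain ⟨g, -, hιg⟩ := hKns hs L hL
    exact ⟨_, inferInstance, Dm.f, ϖ, L, g, hf, hϖ, fun h ↦ absurd h hs, fun _ ↦ hL, hιg⟩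

/-- **Transport in `iff` form at a reducible multiplicative odd `p`** (the datum hypothesis of
`analyticLambdaEq_of_isIsogenous` discharged on both sides by Wuthrich 2014 Thm. 16 `hWu` and
modularity `hpar`; reducibility and the reduction type are themselves class invariants, tree
`X2.IsogenyClassStability`, but are taken on `W` and moved by hand here to keep imports small).
[cite: Wuthrich2014, Thm. 16 (p. 397)] [cite: GreenbergVatsal2000, p. 28] -/
theorem analyticLambdaEq_iff_of_isIsogenous (hWu : thm16_charIdeal_dvd_multiplicative_of_reducible)
    (hpar : nonempty_modularParametrizationData) (hiso : IsIsogenous W W') (hp2 : p ≠ 2)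
    (hmult : W.HasMultiplicativeReductionAtPrime p) (hred : ¬ W.HasIrreducibleModPGaloisRep p)
    (hred' : ¬ W'.HasIrreducibleModPGaloisRep p) (n : ℕ) :
    X2.AnalyticLambdaEq W p n ↔ X2.AnalyticLambdaEq W' p n := by
  have hmult' : W'.HasMultiplicativeReductionAtPrime p :=
    X2.IsogenyQuotientLine.hasMultiplicativeReductionAtPrime_of_isIsogenous hiso hmult
  constructor
  · intro hn
    obtain ⟨N, _, f, ϖ, L, G, hf, hϖ, hLs, hLn, hG⟩ := exists_data hWu hpar hp2 hmult hred
    exact analyticLambdaEq_of_isIsogenous hiso hf hϖ hLs hLn hG hn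
  · intro hn
    obtain ⟨N, _, f, ϖ, L, G, hf, hϖ, hLs, hLn, hG⟩ := exists_data hWu hpar hp2 hmult' hred'
    exact analyticLambdaEq_of_isIsogenous hiso.symm_of_charZero hf hϖ hLs hLn hG hn

end Conjunct

end Summit.BirchSwinnertonDyer.BirchSwinnertonDyer.Theorems.EisensteinPrimesAnalyticLambdaCalculus

end
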